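import Summits.BirchSwinnertonDyer.BirchSwinnertonDyer.Theses.DerivedKatoValuationDoor
import Summits.BirchSwinnertonDyer.BirchSwinnertonDyer.Theorems.DerivedKatoValuationDoorFineLengthLeOneOfAnalyticRankTwoStubIntegralH1RankLeTwoOfDictionary
import Literature.NumberTheory.EllipticCurves.IntegralH1LocalisationRankDictionary
import Literature.NumberTheory.EllipticCurves.PAdicLFunction
import Literature.NumberTheory.EllipticCurves.CuspFormLFunction
import Literature.NumberTheory.EllipticCurves.KuriharaNumber
import Literature.NumberTheory.EllipticCurves.KatoKolyvaginPrimes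
import HarnessLib

/-!
# Line `kurihara` — S2 `IntegralH1RankLeTwoOfAnalyticRankTwo` (stmt-BirchSwinnertonDyer-23752) through KURIHARA COORDINATES
# (strategist seat `cstrat-stmt-BirchSwinnertonDyer-23752` g0, 2026-08-28; runs beside LEAD `bsd-line-dkd-p1`, whose
# registered line `birth` it does NOT touch).

The live line `birth` isolates the research content of S2 in ONE stub, N1∣door
`stub_selCapTwoAtDoorOfAnalyticRankTwo : a = 2 ⇒ corank_{ℤ_p} Sel_{p^∞}(W/ℚ) ≤ 2` at door primes, whose stuck goal is
`⊢ W.selmerCorank p ≤ 2` — a UNIVERSAL statement over Selmer classes with no certifiable instance short of a full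
`p`-descent / `ord_T L_p` computation. This line re-types exactly that stub, and nothing else, in the one coordinate
system in which SOURCE, MAP, LAW and RIGIDITY of Kato's Euler system are all in print and in the tree (Kurihara numbers
`δ_n^{(k)} = kuriharaNumber f (p^k) n ψ ∈ ℤ/p^k`, Kim 2022 Thm. 1.9): N1∣door ⟸ KU ∧ A←, with

* `stub_kim_upper` (KU, PRINT, XL) — `δ_n^{(k)} ≠ 0 ⇒ corank_p ≤ ν(n)` (Kim 2022 Thm. 1.9 (1), upper direction; tree named
  fact `Kim2022_selmerCorank_le_of_kuriharaNumber_ne_zero` + period transfer `realPeriodRat_eq_unit_mul_plusPeriod`);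
  VERBATIM the registered stub KU of line `kurihara-two` (crux `SelmerRankRankTwo`, stmt-BirchSwinnertonDyer-0129) — shared,
  staffed once;
* `stub_exists_delta_of_rank_two` (A←, OPEN, the research stub) — `a = 2 ⇒ ∃ k ≥ 1, ∃ n ∈ 𝒩_k, ν(n) ≤ 2, δ_n^{(k)} ≢ 0`:
  an EXISTENTIAL, instance-certifiable, Selmer-free statement (one non-zero number among a Chebotarev-dense family of
  twisted-`L`-value combinations), with a passing instance in print (Kim 2022 §8: `δ̃^{(1)}_{41·61}(389a1) ≠ 0 ∈ 𝔽_5`);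
  VERBATIM the registered open stub A← of line `kurihara-two` — shared, staffed once (director S0-DOORS §2:
  `KuriharaReceptacleAt W p 2` = this stub at `(W,p)`; `R₂ ⟺ D-U₂` over Kim up/down);
* `stub_crisAtDoorPrimes` (ε, route item stmt-BirchSwinnertonDyer-23148 BY NAME) and `stub_lemme239` (PRINT dictionary
  `PerrinRiou1993.lemme239_rank_integralH1_eq_selmerCorank`, G100) — VERBATIM the registered stubs of line `birth`.

Composition `IntegralH1RankLeTwoOfAnalyticRankTwo_of : KU → A← → ε → L239 → S2` is kernel-checked (no sorry outside
`stub_*`): door ⇒ good ordinary (`isOrdinaryAt_iff`), A← produces `(f,k,n,ψ)` with `δ ≠ 0`, `ν(n) ≤ 2`, KU gives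
`s_p ≤ ν(n) ≤ 2`, then INPUTS' G101 `integralH1RankLeTwo_of_lemme239_of_selCap_of_crisAt` exactly as in `birth`.
What the switch buys and what it does not: card `Lines/kurihara.md` and the strategist's `STRATEGY-CENSUS.md`
(the consumption gap — no theorem in print consumes `L''(E,1) ≠ 0` — is untouched; any proof of A← must see `a = 2`,
since for even `a ≥ 4` the same numbers vanish: line `kurihara-two` stub A→). BSD is not proved by any of this.
-/

set_option linter.dupNamespace false

noncomputable section

open scoped MatrixGroups ModularForm Classical

namespace Summit.BirchSwinnertonDyer.BirchSwinnertonDyer.Cruxes.IntegralH1RankLeTwoOfAnalyticRankTwo.Kurihara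

open CongruenceSubgroup
open Literature Literature.NumberTheory.EllipticCurves Literature.NumberTheory.EllipticCurves.Kato2004
open Literature.NumberTheory.EllipticCurves.Kato2004.EulerSystemValues
open Literature.NumberTheory.EllipticCurves.ModularForms (IsNewformOf)
open Summit.BirchSwinnertonDyer.BirchSwinnertonDyer.Theses.DerivedKatoValuationDoor
open Summit.BirchSwinnertonDyer.BirchSwinnertonDyer.Theorems.DerivedKatoValuationDoor

/-! ## §1 The stubs -/

/-- **Stub KU (`stub_kim_upper`; PRINT, XL) — a non-zero Kurihara number at depth `ν(n)` caps the corank by `ν(n)`.**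
For `W/ℚ` globally minimal, `p ≥ 5` good ordinary with `ρ̄_{E,p}` onto, the newform `f` of `W` at level `N_E`, `k ≥ 1`,
`n ∈ 𝒩_k` (square-free product of Kolyvagin primes of level `k`), surjective discrete logarithms `ψ_ℓ`:
`kuriharaNumber f (p^k) n ψ ≠ 0 ⇒ corank_{ℤ_p} Sel_{p^∞}(W/ℚ) ≤ ν(n)`. In print: Kim 2022 Thm. 1.9 (1) (upper
inequality of `cork = ord(δ̃)`; MR04 Thm. 5.2.12 in Kurihara clothing). Tree: named fact
`Kim2022_selmerCorank_le_of_kuriharaNumber_ne_zero` with its period-transfer hypothesis supplied by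
`realPeriodRat_eq_unit_mul_plusPeriod`. VERBATIM the statement of stub KU of line `kurihara-two` (stmt-0129).
[cite: Kim2022StructureSelmer, Thm. 1.9 (1) (PDF p. 7)] -/
theorem stub_kim_upper :
    ∀ (W : WeierstrassCurve ℚ) [W.IsElliptic] [W.IsGloballyMinimal] (p : ℕ) [Fact p.Prime],
      5 ≤ p → W.HasGoodReductionAtPrime p → ¬ (p : ℤ) ∣ W.frobeniusTrace p →
      W.HasSurjectiveModNGaloisRep p →
      ∀ (_ : NeZero (W.conductorNorm ℤ)) (f : CuspForm (Gamma0 (W.conductorNorm ℤ)) 2),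
        IsNewformOf W f →
        ∀ (k n : ℕ) [NeZero n], 1 ≤ k → Kato.IsKolyvaginProduct W p k n →
          ∀ ψ : (ℓ : ℕ) → (ZMod ℓ)ˣ →* Multiplicative (ZMod (p ^ k)),
            (∀ ℓ ∈ n.primeFactors, Function.Surjective (ψ ℓ)) →
            kuriharaNumber f (p ^ k) n ψ ≠ 0 → W.selmerCorank p ≤ n.primeFactors.card := by
  sorry

/-- **Stub A← (`stub_exists_delta_of_rank_two`; OPEN — the research stub, Selmer-free).** For `W/ℚ` globally minimal,
`p ≥ 5` good ordinary with `ρ̄_{E,p}` onto and `ord_{s=1} L(E,s) = 2`: `N_E > 0`, `W` has a newform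
`f ∈ S₂(Γ₀(N_E))`, and there are `k ≥ 1`, `n ∈ 𝒩_k` with `ν(n) ≤ 2` and surjective discrete logarithms with
`kuriharaNumber f (p^k) n ψ ≠ 0`. By `δ_1 = [0]⁺ = L(E,1)/Ω⁺ = 0` and the functional equation of Kurihara numbers
(`δ_n = 0` unless `(−1)^{ν(n)} = w(E) = +1`) such an `n` has `ν(n) = 2`: some `δ_{ℓℓ'}^{(k)} ≢ 0 (mod p^k)`.
Equivalent to N1∣door at `(W,p)` given KU and Kim's lower direction (director S0-DOORS §2 `kuriharaReceptacleAt_iff_selCapTwoAt`);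
predicted by BSD-rank ∧ `Ш[p^∞]` cotorsion. Evidence channel: `a = 2` is certifiable (`w = +1`, `[0]⁺ = 0` exactly,
`L''(E,1) ≠ 0` by intervals) and each `δ_n^{(k)}` is a finite modular-symbol computation — Kim 2022 §8 (PDF p. 34):
`δ̃^{(1)}_{41·61}(389a1) ≠ 0 ∈ 𝔽_5`; every certified `ord_T L_p(E,T) = 2` (Stein–Wuthrich 2013) is an instance via
Kato 17.4 + Kim's lower direction. WHY IT MIGHT FAIL: only with BSD (`rank 4` at `a = 2`) or with `(ℚ_p/ℤ_p)² ⊂ Ш[p^∞]`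
at a door prime of an `a = 2` curve; the risk is the consumption gap — no theorem turns `L''(E,1) ≠ 0` into anything,
and a proof blind to `a` is impossible (for even `a ≥ 4` all depth-2 numbers vanish: stub A→ of `kurihara-two`).
VERBATIM the registered open stub A← of line `kurihara-two` (stmt-0129) — ONE stub, staffed once.
[cite: Kim2022StructureSelmer, Thm. 1.9 (1), Cor. 1.6, §8 (PDF p. 34)] [cite: CastellaHsieh2022, Conj. 1.2, Rmk. 1.3] -/
theorem stub_exists_delta_of_rank_two :
    ∀ (W : WeierstrassCurve ℚ) [W.IsElliptic] [W.IsGloballyMinimal] (p : ℕ) [Fact p.Prime],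
      5 ≤ p → W.HasGoodReductionAtPrime p → ¬ (p : ℤ) ∣ W.frobeniusTrace p →
      W.HasSurjectiveModNGaloisRep p → W.analyticRank = 2 →
      ∃ (_ : NeZero (W.conductorNorm ℤ)) (f : CuspForm (Gamma0 (W.conductorNorm ℤ)) 2),
        IsNewformOf W f ∧
        ∃ (k n : ℕ) (_ : NeZero n), 1 ≤ k ∧ Kato.IsKolyvaginProduct W p k n ∧
          n.primeFactors.card ≤ 2 ∧
          ∃ ψ : (ℓ : ℕ) → (ZMod ℓ)ˣ →* Multiplicative (ZMod (p ^ k)),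
            (∀ ℓ ∈ n.primeFactors, Function.Surjective (ψ ℓ)) ∧
            kuriharaNumber f (p ^ k) n ψ ≠ 0 := by
  sorry

/-- **Stub ε (`stub_crisAtDoorPrimes`; = route item stmt-BirchSwinnertonDyer-23148 `CrisAtDoorPrimes` BY NAME; size M
given `1 ≤ rank E(ℚ)`, open only on the phantom cell `a = 2 ∧ r = 0`).** At a door prime of an analytic-rank-two curve
some integral class has `loc_p`-image a Kummer local point of non-zero logarithm. VERBATIM the stub of line `birth`.
[cite: PerrinRiou1993AIF, Lemme 2.3.9] [cite: KuriharaPollack2007, Lemma 1.4] -/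
theorem stub_crisAtDoorPrimes : CrisAtDoorPrimes := by
  sorry

/-- **Stub dictionary (`stub_lemme239`; PRINT named fact `PerrinRiou1993.lemme239_rank_integralH1_eq_selmerCorank`, G100,
BY NAME).** `ε_p = 1 ⇒ rank_{ℤ_p} H¹(ℤ[1/p], T_pW) = corank Sel_{p^∞}(W/ℚ)` at an odd good prime (Euler–Poincaré +
Poitou–Tate). VERBATIM the stub of line `birth`.
[cite: PerrinRiou1993AIF, Lemme 2.3.9 (p. 967)] [cite: KuriharaPollack2007, Lemma 1.4] [cite: Kato2004Asterisque, §14.1] -/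
theorem stub_lemme239 : PerrinRiou1993.lemme239_rank_integralH1_eq_selmerCorank := by
  sorry

/-! ## §2 The stub statements as named propositions -/

namespace Statement

/-- Statement of stub KU. [folklore] -/
abbrev stub_kim_upper : Prop := type_of% @Kurihara.stub_kim_upper
/-- Statement of stub A←. [folklore] -/
abbrev stub_exists_delta_of_rank_two : Prop := type_of% @Kurihara.stub_exists_delta_of_rank_two
/-- Statement of stub ε (the route item `CrisAtDoorPrimes` by name). [folklore] -/
abbrev stub_crisAtDoorPrimes : Prop := CrisAtDoorPrimes
/-- Statement of stub L239 (the named fact `PerrinRiou1993.lemme239_rank_integralH1_eq_selmerCorank`). [folklore] -/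
abbrev stub_lemme239 : Prop := PerrinRiou1993.lemme239_rank_integralH1_eq_selmerCorank

end Statement

/-! ## §3 Composition (kernel-checked, no sorry) -/

/-- **N1∣door from KU ∧ A←.** At a door prime (`5 ≤ p`, `IsOrdinaryAt` = good ∧ `p ∤ a_p`, `ρ̄` onto) of a globally
minimal analytic-rank-two curve: A← gives `(f, k, n, ψ)` with `kuriharaNumber f (p^k) n ψ ≠ 0` and `ν(n) ≤ 2`; KU turns
the non-vanishing into `corank_p ≤ ν(n)`. This is the registered signature of `birth`'s stub
`stub_selCapTwoAtDoorOfAnalyticRankTwo` (= hypothesis `hSel` of G101), now DERIVED. [cite: Kim2022StructureSelmer, Thm. 1.9 (1)] -/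
theorem selCapTwoAtDoor_of_kim_upper_of_exists_delta
    (hKU : Statement.stub_kim_upper) (hA : Statement.stub_exists_delta_of_rank_two) :
    ∀ (W : WeierstrassCurve ℚ) [W.IsElliptic] [W.IsGloballyMinimal] (p : ℕ) [Fact p.Prime],
      W.analyticRank = 2 →
        (5 ≤ p ∧ Literature.NumberTheory.EllipticCurves.IsOrdinaryAt W p ∧ W.HasSurjectiveModNGaloisRep p) →
          W.selmerCorank p ≤ 2 := by
  intro W _ _ p _ ha hdoor
  obtain ⟨h5, hord, hsurj⟩ := hdoor
  have hgood : W.HasGoodReductionAtPrime p := ((isOrdinaryAt_iff W p).1 hord).1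
  have hap : ¬ (p : ℤ) ∣ W.frobeniusTrace p := ((isOrdinaryAt_iff W p).1 hord).2
  obtain ⟨hN, f, hf, k, n, hn0, hk, hn, hν, ψ, hψ, hδ⟩ := hA W p h5 hgood hap hsurj ha
  haveI : NeZero n := hn0
  exact (hKU W p h5 hgood hap hsurj hN f hf k n hk hn ψ hψ hδ).trans hν

/-- **Composition: the four stub STATEMENTS (as the named propositions `Statement.stub_*`, the audit's by-name policy)
give the crux BY NAME** — KU ∧ A← ⇒ N1∣door (`selCapTwoAtDoor_of_kim_upper_of_exists_delta`), then INPUTS' landed G101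
`integralH1RankLeTwo_of_lemme239_of_selCap_of_crisAt` exactly as in line `birth`.
[cite: Kim2022StructureSelmer, Thm. 1.9 (1)] [cite: PerrinRiou1993AIF, Lemme 2.3.9] -/
theorem IntegralH1RankLeTwoOfAnalyticRankTwo_of :
    Statement.stub_kim_upper →
    Statement.stub_exists_delta_of_rank_two →
    Statement.stub_crisAtDoorPrimes →
    Statement.stub_lemme239 →
    Summit.BirchSwinnertonDyer.BirchSwinnertonDyer.Theses.DerivedKatoValuationDoor.IntegralH1RankLeTwoOfAnalyticRankTwo := by
  intro hKU hA hCris hPR W _ _ p _ _ ha hdoor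
  exact integralH1RankLeTwo_of_lemme239_of_selCap_of_crisAt hPR
    (selCapTwoAtDoor_of_kim_upper_of_exists_delta hKU hA) hCris W p ha hdoor

/-- The same, from the named stubs (sanity; uses the stubs' sorries by design). -/
theorem IntegralH1RankLeTwoOfAnalyticRankTwo_of_stubs :
    Summit.BirchSwinnertonDyer.BirchSwinnertonDyer.Theses.DerivedKatoValuationDoor.IntegralH1RankLeTwoOfAnalyticRankTwo :=
  IntegralH1RankLeTwoOfAnalyticRankTwo_of stub_kim_upper stub_exists_delta_of_rank_two stub_crisAtDoorPrimes
    stub_lemme239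

end Summit.BirchSwinnertonDyer.BirchSwinnertonDyer.Cruxes.IntegralH1RankLeTwoOfAnalyticRankTwo.Kurihara

end
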